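import Summits.Parity.BatemanHorn.Theorems.SoloInformedTwinUnbalancedPieces
import Literature.NumberTheory.Sieve.BombieriVinogradovMoebius

/-!
# SoloInformedTwinUnbalancedSmallClass — the small-cofactor regime (1a), one cofactor at a time

Solo unit `solo-Parity-informed` (ideation tier, informed mode), session 80; `paper.md` §20
(Theorem 20.1 = (F′), step (1a)), PLAN §60/§62.4 (file F3 of the kernel project F1–F5, first
half; second half = `SoloInformedTwinUnbalancedSmall`), CLAIMS C144.

After `SoloInformedTwinUnbalancedPieces` (packaging P) the switched unbalanced sums are
`S(P_j) = ∑_{k ≤ hi, (k,r₀)=1} innerP(q, k)` with, per cofactor `k`, the INNER CLASS SUM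
`innerP(q,k) = ∑_{e : ke ≡ a (q)} 𝟙[(e,r₀)=1] 𝟙[e ∈ (A_k, hi/k]] μ(e) (log e)^j`
(`A_k = max(y/q, (lo−1)/k)`).  This file bounds, for ONE cofactor `k` prime to `r₀`, the sum
over the moduli `q ≤ z` of `|innerP(q,k)|` by Bombieri–Vinogradov for `μ`:

1. the switched class `ke ≡ a (q)` joined with the parity condition `(e, r₀) = 1`, `r₀ ∈ {1,2}`,
   is ONE residue class modulo `r₀ q` with a representative prime to `r₀ q`
   (`exists_class_rep`: the inverse of `k` modulo `q` and the Chinese remainder theorem — the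
   only place in the project where a modular inverse appears);
2. off the family's moduli the inner sum vanishes (`(k,q) ≠ 1`, or the odd family at even `q`);
3. partial summation (`abs_sum_Ioc_ite_moebius_log_pow_le` of `SoloInformedMoebiusSWHypAux`)
   against a maximising cut-off: `|innerP(q,k)| ≤ 2^{j+1} (log(hi/k))^j max_{t ≤ hi/k} |M(t; r₀q, c)|`
   with `M(t; q', c) = ∑_{n ≤ t, n ≡ c (q')} μ(n)` = `BVMoebius.moebiusAPSum`;
4. **one cofactor** (`sum_abs_innerP_le_of_bv`): the `q`-sum of the maxima is an instance of
   Bombieri–Vinogradov for `μ` without main term over the dilated moduli `r₀ q`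
   (`BVMoebius.sum_abs_moebiusAPSum_dilate_le`, a PROVED Literature theorem, entered here as
   the hypothesis `hBV` in exactly its shape) at the scale `X_k ≥ hi/k` with level `2z`.

The sum over the cofactors `k ≤ K` (harmonic sum, `X_k = hi/k`) and the choice of constants are
in `SoloInformedTwinUnbalancedSmall`.  No bilinear input; no hypothesis beyond PROVED tree theorems.
-/

namespace Summit.Parity.BatemanHorn.Theorems

open Finset Real
open scoped ArithmeticFunction.Moebius
open Literature.NumberTheory.Sieve Literature.NumberTheory.Sieve.BVMoebius

/-! ### 1. The inner class sum of packaging P -/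

/-- The inner class sum of packaging P for modulus `q` and cofactor `k`:
`innerP(q,k) = ∑_{e ≤ hi, ke ≡ a (q)} moebiusLogPiece j r₀ (max(y/q,(lo−1)/k)) (hi/k) e`. -/
noncomputable def innerP (j r₀ lo hi y : ℕ) (a : ℤ) (q k : ℕ) : ℝ :=
  ∑ e ∈ Icc 1 hi, (if ((k * e : ℕ) : ZMod q) = (a : ZMod q)
    then moebiusLogPiece j r₀ (max (y / q) ((lo - 1) / k)) (hi / k) e else 0)

/-- Packaging P in terms of `innerP` (`q ≥ 1`, `lo ≥ 1`):
`S(P_j) = ∑_{k ≤ hi} 𝟙[(k,r₀)=1] · innerP(q, k)`. -/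
theorem switchedSum_moebiusLogCut_eq_sum_innerP {q lo : ℕ} (hq : 0 < q) (hlo : 1 ≤ lo)
    (hi r₀ y j : ℕ) (a : ℤ) :
    switchedSum lo hi q r₀ a (moebiusLogCut y q j)
      = ∑ k ∈ Icc 1 hi, (if k.Coprime r₀ then (1 : ℝ) else 0) * innerP j r₀ lo hi y a q k :=
  switchedSum_moebiusLogCut_eq_piece hq hlo hi r₀ y j a

/-- The inner sum restricted to the piece's interval (`B ≤ hi`):
`∑_{e ≤ hi} 𝟙[P e] piece(A,B)(e) = ∑_{e ∈ (A,B]} 𝟙[P e ∧ (e,r₀)=1] μ(e) (log e)^j`. -/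
theorem sum_ite_moebiusLogPiece_eq_Ioc {hi A B : ℕ} (hB : B ≤ hi) (j r₀ : ℕ) (P : ℕ → Prop)
    [DecidablePred P] :
    ∑ e ∈ Icc 1 hi, (if P e then moebiusLogPiece j r₀ A B e else 0)
      = ∑ e ∈ Ioc A B, (if P e ∧ e.Coprime r₀ then (μ e : ℝ) else 0) * Real.log e ^ j := by
  have hsub : Ioc A B ⊆ Icc 1 hi := fun e he => by
    rw [mem_Ioc] at he
    rw [mem_Icc]
    omega
  rw [← sum_subset hsub (fun e _ he => by rw [moebiusLogPiece_eq_zero_of_not_mem he, ite_self])]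
  refine sum_congr rfl fun e he => ?_
  rw [mem_Ioc] at he
  unfold moebiusLogPiece
  by_cases hP : P e <;> by_cases hc : e.Coprime r₀ <;> simp [hP, hc, he.1, he.2]

/-- **Partial summation for the inner sum**: a uniform bound `M` for the class sums
`|∑_{n ≤ t, P n, (n,r₀)=1} μ(n)|`, `1 ≤ t ≤ B ≤ hi`, gives `|inner| ≤ 2^{j+1} M (log B)^j`. -/
theorem abs_sum_ite_moebiusLogPiece_le {hi A B : ℕ} (hB : B ≤ hi) (j r₀ : ℕ) (P : ℕ → Prop)
    [DecidablePred P] {M : ℝ} (hM0 : 0 ≤ M)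
    (hM : ∀ t : ℕ, 1 ≤ t → t ≤ B →
      |∑ n ∈ (Icc 1 t).filter (fun n => P n ∧ n.Coprime r₀), (μ n : ℝ)| ≤ M) :
    |∑ e ∈ Icc 1 hi, (if P e then moebiusLogPiece j r₀ A B e else 0)|
      ≤ 2 ^ (j + 1) * M * Real.log B ^ j := by
  rw [sum_ite_moebiusLogPiece_eq_Ioc hB j r₀ P]
  rcases le_or_gt A B with hAB | hAB
  · exact abs_sum_Ioc_ite_moebius_log_pow_le hM0 hM j hAB
  · rw [Finset.Ioc_eq_empty (by omega), sum_empty, abs_zero]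
    exact mul_nonneg (mul_nonneg (by positivity) hM0) (pow_nonneg (Real.log_natCast_nonneg B) j)

/-! ### 2. The switched class with the parity condition is ONE class modulo `r₀ q` -/

/-- For `r₀ ∈ {1, 2}`: `(n, r₀) = 1 ↔ n ≡ 1 (mod r₀)`. -/
theorem coprime_iff_modEq_one {r₀ : ℕ} (hr₀ : r₀ = 1 ∨ r₀ = 2) (n : ℕ) :
    n.Coprime r₀ ↔ n ≡ 1 [MOD r₀] := by
  rcases hr₀ with rfl | rfl
  · exact iff_of_true (Nat.coprime_one_right _) Nat.modEq_one
  · rw [Nat.coprime_two_right, Nat.odd_iff, Nat.ModEq]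

/-- `(q, a) = 1` over `ℤ` makes `a` a unit of `ZMod q`. -/
theorem isUnit_intCast_zmod_of_isCoprime {q : ℕ} {a : ℤ} (ha : IsCoprime (q : ℤ) a) :
    IsUnit (a : ZMod q) := by
  obtain ⟨u, v, huv⟩ := ha
  have h : (v : ZMod q) * (a : ZMod q) = 1 := by
    have h' := congrArg (Int.cast : ℤ → ZMod q) huv
    push_cast at h'
    simpa [ZMod.natCast_self] using h'
  exact IsUnit.of_mul_eq_one_right (v : ZMod q) h

/-- **The class representative**: for `r₀ ∈ {1,2}`, `(q, r₀) = (k, q) = 1`, `(q, a) = 1`, there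
is `c` prime to `r₀ q` with `(ke ≡ a (q) ∧ (e, r₀) = 1) ↔ e ≡ c (mod r₀ q)` (inverse of `k`
modulo `q`, then the Chinese remainder theorem). -/
theorem exists_class_rep {r₀ q k : ℕ} {a : ℤ} (hr₀ : r₀ = 1 ∨ r₀ = 2) (hq : 0 < q)
    (hqr : q.Coprime r₀) (hkq : k.Coprime q) (ha : IsCoprime (q : ℤ) a) :
    ∃ c : ℕ, c.Coprime (r₀ * q) ∧ ∀ n : ℕ,
      (((k * n : ℕ) : ZMod q) = (a : ZMod q) ∧ n.Coprime r₀) ↔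
        (n : ZMod (r₀ * q)) = ((c : ℕ) : ZMod (r₀ * q)) := by
  haveI : NeZero q := ⟨hq.ne'⟩
  set u : (ZMod q)ˣ := ZMod.unitOfCoprime k hkq with hu_def
  have hu : (u : ZMod q) = (k : ZMod q) := ZMod.coe_unitOfCoprime k hkq
  obtain ⟨w, hw⟩ := isUnit_intCast_zmod_of_isCoprime ha
  set c₀ : ℕ := ((u⁻¹ * w : (ZMod q)ˣ) : ZMod q).val with hc₀_def
  have hc₀ : ((c₀ : ℕ) : ZMod q) = ((u⁻¹ * w : (ZMod q)ˣ) : ZMod q) := ZMod.natCast_zmod_val _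
  have hc₀cop : c₀.Coprime q := by
    refine (ZMod.isUnit_iff_coprime c₀ q).mp ?_
    rw [hc₀]
    exact Units.isUnit _
  obtain ⟨c, hc₁, hc₂⟩ := Nat.chineseRemainder hqr c₀ 1
  have h1 : c.Coprime r₀ := by
    show Nat.gcd c r₀ = 1
    rw [hc₂.gcd_eq, Nat.gcd_one_left]
  have h2 : c.Coprime q := by
    show Nat.gcd c q = 1
    rw [hc₁.gcd_eq]
    exact hc₀cop
  refine ⟨c, Nat.Coprime.mul_right h1 h2, fun n => ?_⟩
  have e1 : n.Coprime r₀ ↔ n ≡ c [MOD r₀] :=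
    (coprime_iff_modEq_one hr₀ n).trans ⟨fun h => h.trans hc₂.symm, fun h => h.trans hc₂⟩
  have e2 : (((k * n : ℕ) : ZMod q) = (a : ZMod q)) ↔ n ≡ c [MOD q] := by
    rw [show (n ≡ c [MOD q]) ↔ (n ≡ c₀ [MOD q]) from
        ⟨fun h => h.trans hc₁, fun h => h.trans hc₁.symm⟩,
      ← ZMod.natCast_eq_natCast_iff, hc₀, Nat.cast_mul, ← hu, ← hw, Units.val_mul]
    constructor
    · intro h
      rw [← h, ← mul_assoc, Units.inv_mul, one_mul]
    · intro h
      rw [h, ← mul_assoc, Units.mul_inv, one_mul]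
  rw [ZMod.natCast_eq_natCast_iff, ← Nat.modEq_and_modEq_iff_modEq_mul hqr.symm, e1, e2]
  exact ⟨fun h => ⟨h.2, h.1⟩, fun h => ⟨h.2, h.1⟩⟩

/-! ### 3. Off the family's moduli the inner sum vanishes -/

/-- If `(k, q) ≠ 1` (and `(q, a) = 1`) no `e` satisfies `ke ≡ a (q)`: `innerP(q,k) = 0`. -/
theorem innerP_eq_zero_of_not_coprime {k q : ℕ} {a : ℤ} (ha : IsCoprime (q : ℤ) a)
    (hkq : ¬ k.Coprime q) (j r₀ lo hi y : ℕ) : innerP j r₀ lo hi y a q k = 0 := by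
  refine sum_eq_zero fun e _ => ?_
  rw [if_neg]
  exact fun h => hkq (coprime_and_coprime_of_switch_cond h ha).1

/-- The odd family (`r₀ = 2`, `2 ∣ a`, `k` odd) vanishes at even moduli: `innerP(q,k) = 0`. -/
theorem innerP_eq_zero_of_even {k q : ℕ} {a : ℤ} (hq : 2 ∣ q) (ha2 : (2 : ℤ) ∣ a)
    (hk : k.Coprime 2) (j lo hi y : ℕ) : innerP j 2 lo hi y a q k = 0 := by
  refine sum_eq_zero fun e _ => ?_
  split_ifs with hcl
  · unfold moebiusLogPiece
    rw [if_neg]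
    rintro ⟨-, -, he⟩
    have hcop : (k * e).Coprime 2 := Nat.Coprime.mul_left hk he
    rw [natCast_zmod_eq_intCast_iff] at hcl
    have h2 : (2 : ℤ) ∣ ((k * e : ℕ) : ℤ) := by
      have h1 : (2 : ℤ) ∣ a - (k * e : ℕ) := (Int.natCast_dvd_natCast.mpr hq).trans hcl
      have h' := dvd_sub ha2 h1
      rwa [sub_sub_cancel] at h'
    have h3 : 2 ∣ k * e := Int.natCast_dvd_natCast.mp h2
    have h4 : Nat.gcd (k * e) 2 = 1 := hcop
    have : (2 : ℕ) ∣ 1 := h4 ▸ Nat.dvd_gcd h3 (dvd_refl 2)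
    omega
  · rfl

/-! ### 4. One cofactor: Bombieri–Vinogradov for `μ` over the dilated moduli `r₀ q` -/

/-- **One cofactor.**  Let `hBV` be Bombieri–Vinogradov for `μ` without main term over dilated
moduli (the statement of `BVMoebius.sum_abs_moebiusAPSum_dilate_le` for the exponent `A'`).
For the family `r₀ = 1` (any `a` prime to every modulus) or `r₀ = 2` with `2 ∣ a` (`a` prime to
the odd moduli), a cofactor `k` prime to `r₀`, and a scale `X_k ≥ X₀` with `hi/k ≤ X_k` and
level `2z ≤ X_k^{1/2}(log X_k)^{-B}`:
`∑_{q ≤ z} |innerP(q,k)| ≤ 2^{j+1} (log(hi/k))^j · C X_k (log X_k)^{-A'}`. -/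
theorem sum_abs_innerP_le_of_bv {A' B C X₀ : ℝ}
    (hBV : ∀ x : ℝ, X₀ ≤ x → ∀ k : ℕ, 0 < k → ∀ 𝒟 : Finset ℕ,
      (∀ d ∈ 𝒟, 1 ≤ d ∧ ((k * d : ℕ) : ℝ) ≤ x ^ (1 / 2 : ℝ) / Real.log x ^ B) →
      ∀ t : ℕ → ℕ, (∀ d, (t d : ℝ) ≤ x) → ∀ a : ℕ → ℕ, (∀ d ∈ 𝒟, (a d).Coprime (k * d)) →
        ∑ d ∈ 𝒟, |moebiusAPSum (t d) (k * d) ((a d : ℕ) : ZMod (k * d))|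
          ≤ C * x / Real.log x ^ A')
    {r₀ : ℕ} {a : ℤ} (hfam : r₀ = 1 ∨ (r₀ = 2 ∧ (2 : ℤ) ∣ a))
    (ha : ∀ q : ℕ, q.Coprime r₀ → IsCoprime (q : ℤ) a)
    {k : ℕ} (hkr : k.Coprime r₀) (j lo hi y z : ℕ) {Xk : ℝ} (hX₀ : X₀ ≤ Xk)
    (hhi : ((hi / k : ℕ) : ℝ) ≤ Xk) (hlev : (2 * z : ℝ) ≤ Xk ^ (1 / 2 : ℝ) / Real.log Xk ^ B) :
    ∑ q ∈ Icc 1 z, |innerP j r₀ lo hi y a q k|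
      ≤ 2 ^ (j + 1) * Real.log ((hi / k : ℕ) : ℝ) ^ j * (C * Xk / Real.log Xk ^ A') := by
  have hr₀ : r₀ = 1 ∨ r₀ = 2 := hfam.imp_right And.left
  have hr₀pos : 0 < r₀ := by rcases hr₀ with rfl | rfl <;> norm_num
  have hr₀2 : r₀ ≤ 2 := by rcases hr₀ with rfl | rfl <;> norm_num
  set B' := hi / k with hB'
  set 𝒟 := (Icc 1 z).filter (fun q => q.Coprime r₀ ∧ k.Coprime q) with h𝒟
  -- class representatives on the family's moduli
  have hrep : ∀ q, q ∈ 𝒟 → ∃ c : ℕ, c.Coprime (r₀ * q) ∧ ∀ n : ℕ,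
      (((k * n : ℕ) : ZMod q) = (a : ZMod q) ∧ n.Coprime r₀) ↔
        (n : ZMod (r₀ * q)) = ((c : ℕ) : ZMod (r₀ * q)) := by
    intro q hq
    rw [h𝒟, mem_filter, mem_Icc] at hq
    exact exists_class_rep hr₀ (by omega) hq.2.1 hq.2.2 (ha q hq.2.1)
  choose! c hcc hciff using hrep
  -- maximising cut-offs
  have hmax : ∀ q : ℕ, ∃ t ∈ Icc 0 B', ∀ t' ∈ Icc 0 B',
      |moebiusAPSum t' (r₀ * q) ((c q : ℕ) : ZMod (r₀ * q))| ≤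
        |moebiusAPSum t (r₀ * q) ((c q : ℕ) : ZMod (r₀ * q))| := fun q =>
    exists_max_image (Icc 0 B') (fun t => |moebiusAPSum t (r₀ * q) ((c q : ℕ) : ZMod (r₀ * q))|)
      ⟨0, by simp⟩
  choose t ht htmax using hmax
  -- Bombieri–Vinogradov at the scale `X_k` with the moduli `r₀ q`, `q ∈ 𝒟`
  have hD : ∀ d ∈ 𝒟, 1 ≤ d ∧ ((r₀ * d : ℕ) : ℝ) ≤ Xk ^ (1 / 2 : ℝ) / Real.log Xk ^ B := by
    intro d hd
    rw [h𝒟, mem_filter, mem_Icc] at hd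
    refine ⟨hd.1.1, le_trans ?_ hlev⟩
    have : r₀ * d ≤ 2 * z := Nat.mul_le_mul hr₀2 hd.1.2
    exact_mod_cast this
  have htle : ∀ d, (t d : ℝ) ≤ Xk := fun d =>
    le_trans (by exact_mod_cast (mem_Icc.mp (ht d)).2) hhi
  have hBVk := hBV Xk hX₀ r₀ hr₀pos 𝒟 hD t htle c hcc
  -- per modulus in the family
  have hin : ∀ q ∈ 𝒟, |innerP j r₀ lo hi y a q k| ≤
      2 ^ (j + 1) * |moebiusAPSum (t q) (r₀ * q) ((c q : ℕ) : ZMod (r₀ * q))|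
        * Real.log (B' : ℝ) ^ j := by
    intro q hq
    refine abs_sum_ite_moebiusLogPiece_le (Nat.div_le_self hi k) j r₀ _ (abs_nonneg _)
      fun t' _ ht'B => ?_
    have hfil : (Icc 1 t').filter (fun n => ((k * n : ℕ) : ZMod q) = (a : ZMod q) ∧ n.Coprime r₀)
        = (Icc 1 t').filter (fun n : ℕ => (n : ZMod (r₀ * q)) = ((c q : ℕ) : ZMod (r₀ * q))) :=
      filter_congr fun n _ => hciff q hq n
    rw [hfil]
    exact htmax q t' (mem_Icc.mpr ⟨Nat.zero_le _, ht'B⟩)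
  -- per modulus off the family
  have hout : ∀ q ∈ Icc 1 z, q ∉ 𝒟 → innerP j r₀ lo hi y a q k = 0 := by
    intro q hq hqD
    by_cases h1 : q.Coprime r₀
    · have h2 : ¬ k.Coprime q := fun h2 => hqD (by rw [h𝒟, mem_filter]; exact ⟨hq, h1, h2⟩)
      exact innerP_eq_zero_of_not_coprime (ha q h1) h2 j r₀ lo hi y
    · rcases hfam with hr1 | ⟨hr2, ha2⟩
      · exact absurd (by rw [hr1]; exact Nat.coprime_one_right q) h1
      · subst hr2
        have hq2 : 2 ∣ q := by
          rcases Nat.even_or_odd q with he | ho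
          · exact he.two_dvd
          · exact absurd (Nat.coprime_two_right.mpr ho) h1
        exact innerP_eq_zero_of_even hq2 ha2 hkr j lo hi y
  -- assemble
  have hlog0 : 0 ≤ Real.log (B' : ℝ) ^ j := pow_nonneg (Real.log_natCast_nonneg _) j
  calc ∑ q ∈ Icc 1 z, |innerP j r₀ lo hi y a q k|
      = ∑ q ∈ 𝒟, |innerP j r₀ lo hi y a q k| := by
        refine (sum_subset (filter_subset _ _) fun q hq hqD => ?_).symm
        rw [hout q hq hqD, abs_zero]
    _ ≤ ∑ q ∈ 𝒟, 2 ^ (j + 1) * |moebiusAPSum (t q) (r₀ * q) ((c q : ℕ) : ZMod (r₀ * q))|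
          * Real.log (B' : ℝ) ^ j := sum_le_sum hin
    _ = 2 ^ (j + 1) * Real.log (B' : ℝ) ^ j *
          ∑ q ∈ 𝒟, |moebiusAPSum (t q) (r₀ * q) ((c q : ℕ) : ZMod (r₀ * q))| := by
        rw [mul_sum]
        exact sum_congr rfl fun q _ => by ring
    _ ≤ 2 ^ (j + 1) * Real.log (B' : ℝ) ^ j * (C * Xk / Real.log Xk ^ A') :=
        mul_le_mul_of_nonneg_left hBVk (mul_nonneg (by positivity) hlog0)

end Summit.Parity.BatemanHorn.Theorems
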